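import Literature.NumberTheory.Automorphic.UnitaryGroupTruncatedKernelClassCellBoundTwo
import Literature.NumberTheory.Automorphic.UnitaryGroupTruncatedKernelClassIntegrableOfCuspTwo
import Literature.NumberTheory.Automorphic.UnitaryGroupCuspIntegralSiegelMajorantTwo
import Literature.NumberTheory.Automorphic.UnitaryGroupBorelLatticeCellCountSiegelTwo
import Literature.NumberTheory.Automorphic.AdelicUnitaryGroupUnimodularQuasiSplit
import Literature.NumberTheory.Automorphic.UnitaryGroupIwasawaAdelic
import Literature.NumberTheory.Automorphic.UnitaryGroupBorelConstantTermIndependence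
import HarnessLib

/-!
# Per-class integrability of Arthur's truncated kernel `k^T_𝔬` on `U(J₂)` from the rows: the Siegel
# majorant `Φ = (C₀ δ_B / ν(𝓕₀)) · Lρ` bounds EVERY `‖K_𝔬 − K_{B,𝔬}‖` (the `N = 2` twin of
# ★ `UnitaryGroupTruncatedKernelClassIntegrableOfRows`)
(Arthur, *A trace formula for reductive groups I*, Duke Math. J. 45 (1978), Thm. 7.1 and §8 — the
integrability of `k^T_𝔬` is proved class by class; Rogawski, *Automorphic Representations of Unitary Groups
in Three Variables* (1990), §2.2 p. 13: «Furthermore, `k^T_𝔬` is integrable over `𝐙G\𝐆`», with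
«`G = U(3)`, `U(2)`, or `U(2) × U(1)`», p. 98.)

Topic `NumberTheory/Automorphic`; namespace `Literature.NumberTheory.Automorphic.UnitaryGroup`. THEOREMS ONLY
(no definition, no named fact, no instance, no notation, no `sorry`). H-side copy of LAWS 1–5 for
`H = U(Φ₂) × U(Φ₁)` (hodgecm-mathlib, F0P3a LEAD WORD #123∕#124; census `CENSUS-LAWS-Hside` §3 LAW 1 «rows →
closer», «class rows first»; desk TABLE #1 row (H-L1-cusp), NEXT-3 item (R3)) — the ASSEMBLY of the `U(J₂)`
row package over the abstract class map `cl : G(F) → ι` of ★ `UnitaryGroupArthurKernelClassExpansion`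
(`IsConjInvariant`, `IsUnipotentInvariantOnBorel`, every `N`):

* INPUTS ★ (per class, `N = 2`): the class Siegel property `K_𝔬(g,g) = Σ_{B(F) ∩ 𝔬}` high in the cusp and
  `k^T_𝔬 = K_𝔬 − K_{B,𝔬}` above the cut-off (★ `UnitaryGroupTruncatedKernelClassHighCuspTwo`), the class
  oscillation head `‖k^T_𝔬(g)‖ ≤ #R · Lρ` from the ONE-FACTOR normal form with the SAME `R`, `U`, `L` for every
  class (★ `IsQuasiSplitTest.exists_level_norm_truncatedKernelClass_le_two`, `UnitaryGroupTruncatedKernelClassCellBoundTwo`),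
  the per-class reduction of integrability to a cusp estimate (★
  `integrable_quotFun_truncatedKernelClass_of_cusp_estimate_two`, `UnitaryGroupTruncatedKernelClassIntegrableOfCuspTwo`)
  and the per-class cusp estimate from a majorant (★ `exists_cover_setLIntegral_class_lt_top_of_majorant_two`,
  `UnitaryGroupCuspIntegralSiegelMajorantTwo`);
  INPUTS ★ (class-agnostic, `N = 2`): the cell count on the LINE ★
  `exists_forall_card_mul_measure_le_mul_torusRootModulus_two` (`UnitaryGroupBorelLatticeCellCountSiegelTwo`:
  ONE root value `(d 0)⁻¹ d 1`), `K_U` compact and height preserving (every `N`).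
* HYPOTHESIS: the `U(J₂)` ROW PACKAGE `hrows` — the `N = 2` shape of the package of ★
  `truncatedKernelIntegrable_of_rows`: a closed `K_U`-saturated Siegel set `S ⊆ B(𝔸)` covering `G(𝔸)` mod
  `B(F)`, a structure clause above height `T₀` (unipotent part in a compact `Ω`, the ONE root value
  `(d 0)⁻¹ d 1 ∈ R₁` compact), and for every level `U`: a fundamental domain `𝓕₀ ⊆ W₀` of `N(F)`, the
  ONE-FACTOR geometry of `(bk)⁻¹ 𝓕₀ (bk)` at scale `ρ(b)`, and `∫⁻_{S ∩ {H > T}} δ_B ρ dμ_B < ∞` (rows typed at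
  `N = 2` by ★ `UnitaryGroupBorelSiegelSet[Structure]Two`, `UnitaryGroupSiegelRootNormDecayTwo`, the thin-set and
  product-weight rows; discharged at the CM pair by the `…IntegrableOfSiegelTwo` file).

WHAT IS PROVED.
* §0 `kernelBorelClass_eq_of_isFundamentalDomain_two` — `K_{B,𝔬}` does not depend on `(ν, 𝓕)` (★
  `borelSumClass_unipotent_mul`, ★ `borelConstantTerm_eq_of_isHaarMeasure`, every `N`).
* §1 `enorm_kernelClass_sub_kernelBorelClass_le_majorant_two` — THE POINTWISE MAJORANT, class by class:
  `‖K_𝔬(bk,bk) − K_{B,𝔬}(bk,bk)‖ₑ ≤ C₀ · ν(𝓕₀)⁻¹ · L · δ_B(b) · ρ` — the classless `Φ`.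
* §2 `exists_majorant_class_of_rows_two` — `hest ∧ hΦ` for every class with ONE `Φ`.
* §3 **`truncatedKernelClassIntegrable_of_rows_two`** (generic quadratic `E/F`, `c² = 1`, `c ≠ 1`, unimodularity
  `hunimod` and the Iwasawa decomposition `hBK` as hypotheses) and **`truncatedKernelClassIntegrable_cm_of_rows_two`**
  (CM pair `L/L⁺`: `hc`, `hc1`, unimodularity ★ `forall_isHaarMeasure_isMulRightInvariant_quasiSplit_cm_two`, `hBK` ★
  `exists_mem_borelAdelic_mul_mem_standardMaximalCompactGL_cm` DISCHARGED): for every class `𝔬`,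
  `[g] ↦ k^T_𝔬(g⁻¹)` is integrable on `G(F)∖G(𝔸_F)` for all large `T`, modulo `hrows` alone.

HC_CM is proved only modulo the 7 printed citations until rung 0 closes.

## References

* J. Arthur, *A trace formula for reductive groups I*, Duke Math. J. 45 (1978), Thm. 7.1, §8 (pp. 947–950)
  [Arthur1978TraceFormulaI].
* J. D. Rogawski, *Automorphic Representations of Unitary Groups in Three Variables*, Ann. of Math. Stud.
  123 (1990), §2.2 (p. 13), §7.3 (p. 98) [Rogawski1990].
* S. Shokranian, *The Selberg–Arthur Trace Formula*, LNM 1503 (1992), §5.2 [Shokranian1992].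
-/

set_option autoImplicit false

noncomputable section

open MeasureTheory Measure NumberField NumberField.mixedEmbedding IsDedekindDomain Set
open scoped NNReal ENNReal Pointwise MatrixGroups Classical

namespace Literature.NumberTheory.Automorphic

namespace UnitaryGroup

variable {F E : Type} [Field F] [NumberField F] [Field E] [NumberField E] [Algebra F E]
  {c : E ≃ₐ[F] E} {ι : Type*}

section Rows

variable [MeasurableSpace (adelicUnipotent F E c 2)] [BorelSpace (adelicUnipotent F E c 2)]

/-! ## §0 `K_{B,𝔬}` does not depend on the unipotent data `(ν, 𝓕)` -/

/-- **`K_{B,𝔬}^{ν,𝓕} = K_{B,𝔬}^{ν',𝓕'}`**: the class Borel kernel is the Borel constant term of the class Borel sum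
`z ↦ Σ_{β ∈ B(F), cl β = 𝔬} f(x⁻¹ β z)`, which is left `N(F)`-invariant (★ `borelSumClass_unipotent_mul`, the
`N(F)`-saturation `hclN` of the classes on `B(F)`), so ★ `borelConstantTerm_eq_of_isHaarMeasure` applies.
[cite: Rogawski1990, §2.2 (p. 13)] -/
theorem kernelBorelClass_eq_of_isFundamentalDomain_two (ν ν' : Measure (adelicUnipotent F E c 2))
    [ν.IsHaarMeasure] [ν'.IsHaarMeasure] {𝓕 𝓕' : Set (adelicUnipotent F E c 2)}
    (h𝓕 : IsFundamentalDomain (rationalUnipotent F E c 2) 𝓕 ν)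
    (h𝓕' : IsFundamentalDomain (rationalUnipotent F E c 2) 𝓕' ν')
    {cl : (quasiSplit F E c 2).arithmeticSubgroup → ι} (hclN : IsUnipotentInvariantOnBorel F E c 2 cl) (i : ι)
    (f : (quasiSplit F E c 2).Adelic → ℂ) :
    kernelBorelClass ν 𝓕 cl i f = kernelBorelClass ν' 𝓕' cl i f := by
  funext x y
  rw [kernelBorelClass_def, kernelBorelClass_def,
    borelConstantTerm_eq_of_isHaarMeasure ν ν' h𝓕 h𝓕'
      (fun u hu z => borelSumClass_unipotent_mul hclN i f x z
        ⟨(u : (quasiSplit F E c 2).Adelic), Subgroup.mem_comap.1 hu⟩ u.2)]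

/-! ## §1 The pointwise majorant, class by class -/

omit [MeasurableSpace (adelicUnipotent F E c 2)] [BorelSpace (adelicUnipotent F E c 2)] in
/-- Coercion plumbing: `insert 1 (↑W₀)` in `G(𝔸)` is the image of `insert 1 W₀ ⊆ N(𝔸)`. [folklore] -/
private theorem mem_image_insert_one_of_mem_insert₈ {W₀ : Set (adelicUnipotent F E c 2)}
    {y : (quasiSplit F E c 2).Adelic}
    (hy : y ∈ insert (1 : (quasiSplit F E c 2).Adelic)
      ((fun u : adelicUnipotent F E c 2 => (u : (quasiSplit F E c 2).Adelic)) '' W₀)) :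
    ∃ y' ∈ insert (1 : adelicUnipotent F E c 2) W₀, (y' : (quasiSplit F E c 2).Adelic) = y := by
  rcases hy with rfl | ⟨u, hu, rfl⟩
  · exact ⟨1, Set.mem_insert _ _, rfl⟩
  · exact ⟨u, Set.mem_insert_of_mem _ hu, rfl⟩

/-- **THE POINTWISE MAJORANT ON THE SIEGEL SET, CLASS BY CLASS.**  In the setting of ★
`enorm_kernel_sub_kernelBorel_le_majorant` with the class oscillation head `hH5` (★
`IsQuasiSplitTest.exists_level_norm_truncatedKernelClass_le_two`: `‖k^T_𝔬(g)‖ ≤ #R · Lρ`, the same `R` for every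
class) and the class Siegel property `hc₀` (★ `exists_forall_kernelClass_eq_borelSumClass_of_lt_borelHeight_two`): for
`b` reduced, `k ∈ K_U`, `max(1, c₀) ≤ T < H(b)` and the one-factor geometry at scale `ρ` (`U(J₂)`),
`‖K_𝔬(bk,bk) − K_{B,𝔬}^{ν,𝓕}(bk,bk)‖ₑ ≤ C₀ · ν(𝓕₀)⁻¹ · L · δ_B(b) · ρ` for EVERY class `𝔬`.
[cite: Arthur1978TraceFormulaI, Thm. 7.1] [cite: Rogawski1990, §2.2 (p. 13)] -/
theorem enorm_kernelClass_sub_kernelBorelClass_le_majorant_two (ν : Measure (adelicUnipotent F E c 2)) [ν.IsHaarMeasure]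
    {𝓕 𝓕₀ W₀ : Set (adelicUnipotent F E c 2)}
    (h𝓕 : IsFundamentalDomain (rationalUnipotent F E c 2) 𝓕 ν)
    (h𝓕₀ : IsFundamentalDomain (rationalUnipotent F E c 2) 𝓕₀ ν) (hW₀ : IsCompact W₀) (h𝓕₀W₀ : 𝓕₀ ⊆ W₀)
    {cl : (quasiSplit F E c 2).arithmeticSubgroup → ι} (hcl : IsConjInvariant cl)
    (hclN : IsUnipotentInvariantOnBorel F E c 2 cl) (i : ι)
    {f : (quasiSplit F E c 2).Adelic → ℂ}
    {S_dir : Set (Matrix (Fin 2) (Fin 2) (mixedSpace E))} {U : Subgroup (GL (Fin 2) (AdeleRing (𝓞 E) E))}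
    {L : ℝ} (hL : 0 ≤ L)
    (hH5 : ∀ {T : ℝ≥0}, 1 ≤ T → ∀ {g : (quasiSplit F E c 2).Adelic}, T < borelHeight g →
        kernelClass cl i f g g = borelSumClass cl i f g g → ∀ (ρ : ℝ),
        (∀ u ∈ 𝓕₀, ∃ (t : ℝ) (X : Matrix (Fin 2) (Fin 2) (mixedSpace E))
            (w : GL (Fin 2) (AdeleRing (𝓞 E) E)), X ∈ S_dir ∧ w ∈ U ∧ |t| ≤ ρ ∧
          adelicVal F E c 2 _ (g⁻¹ * (u : (quasiSplit F E c 2).Adelic) * g) =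
            GLn.ofInfinite 2 E (expGL (t • X)) * w) →
        ∃ R : Finset (arithmeticBorel F E c 2),
          (∀ β ∈ R, ∃ y ∈ insert (1 : (quasiSplit F E c 2).Adelic)
              ((fun u : adelicUnipotent F E c 2 => (u : (quasiSplit F E c 2).Adelic)) '' W₀),
            g⁻¹ * (((β : (quasiSplit F E c 2).arithmeticSubgroup)) : (quasiSplit F E c 2).Adelic) *
              (y * g) ∈ tsupport f) ∧
          ‖truncatedKernelClass ν 𝓕₀ T cl i f g‖ ≤ R.card * (L * ρ))
    {Ω : Set (quasiSplit F E c 2).Adelic} {R₁ : Set (AdeleRing (𝓞 E) E)} {C₀ : ℝ≥0}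
    (hH4 : ∀ b : borelAdelic F E c 2,
      (((torusPart b)⁻¹ * b : borelAdelic F E c 2) : (quasiSplit F E c 2).Adelic) ∈ Ω →
      (((diagUnit b.2 0)⁻¹ * diagUnit b.2 1 : (AdeleRing (𝓞 E) E)ˣ) : AdeleRing (𝓞 E) E) ∈ R₁ →
      ∀ k ∈ (((standardMaximalCompactGL 2 E).comap (adelicVal F E c 2 ((StdForm.antidiagonal 2).over E)) :
          Subgroup (quasiSplit F E c 2).Adelic) : Set (quasiSplit F E c 2).Adelic),
        ∀ R : Finset (arithmeticBorel F E c 2),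
        (∀ β ∈ R, ∃ y ∈ insert (1 : adelicUnipotent F E c 2) W₀, ((b : (quasiSplit F E c 2).Adelic) * k)⁻¹ *
          (((β : (quasiSplit F E c 2).arithmeticSubgroup)) : (quasiSplit F E c 2).Adelic) *
          ((y : (quasiSplit F E c 2).Adelic) * ((b : (quasiSplit F E c 2).Adelic) * k)) ∈ tsupport f) →
        (R.card : ℝ≥0∞) * ν 𝓕₀ ≤ (C₀ : ℝ≥0∞) * ((torusRootModulus E 2 (diagUnit b.2) : ℝ≥0) : ℝ≥0∞))
    {c₀ : ℝ≥0} (hc₀ : ∀ g : (quasiSplit F E c 2).Adelic, c₀ < borelHeight g →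
      kernelClass cl i f g g = borelSumClass cl i f g g)
    {T : ℝ≥0} (hT1 : 1 ≤ T) (hTc₀ : c₀ ≤ T)
    {b : borelAdelic F E c 2}
    (hbΩ : (((torusPart b)⁻¹ * b : borelAdelic F E c 2) : (quasiSplit F E c 2).Adelic) ∈ Ω)
    (hb₁ : (((diagUnit b.2 0)⁻¹ * diagUnit b.2 1 : (AdeleRing (𝓞 E) E)ˣ) : AdeleRing (𝓞 E) E) ∈ R₁)
    {k : (quasiSplit F E c 2).Adelic}
    (hk : adelicVal F E c 2 ((StdForm.antidiagonal 2).over E) k ∈ standardMaximalCompactGL 2 E)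
    (hTb : T < borelHeight (b : (quasiSplit F E c 2).Adelic)) {ρ : ℝ}
    (hgeom : ∀ u ∈ 𝓕₀, ∃ (t : ℝ) (X : Matrix (Fin 2) (Fin 2) (mixedSpace E))
        (w : GL (Fin 2) (AdeleRing (𝓞 E) E)), X ∈ S_dir ∧ w ∈ U ∧ |t| ≤ ρ ∧
      adelicVal F E c 2 _ ((((b : (quasiSplit F E c 2).Adelic) * k)⁻¹ *
          (u : (quasiSplit F E c 2).Adelic) * ((b : (quasiSplit F E c 2).Adelic) * k))) =
        GLn.ofInfinite 2 E (expGL (t • X)) * w) :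
    (‖kernelClass cl i f ((b : (quasiSplit F E c 2).Adelic) * k) ((b : (quasiSplit F E c 2).Adelic) * k) -
        kernelBorelClass ν 𝓕 cl i f ((b : (quasiSplit F E c 2).Adelic) * k)
          ((b : (quasiSplit F E c 2).Adelic) * k)‖ₑ : ℝ≥0∞) ≤
      (C₀ : ℝ≥0∞) * (ν 𝓕₀)⁻¹ * ENNReal.ofReal L *
        (((torusRootModulus E 2 (diagUnit b.2) : ℝ≥0) : ℝ≥0∞) * ENNReal.ofReal ρ) := by
  set g : (quasiSplit F E c 2).Adelic := (b : (quasiSplit F E c 2).Adelic) * k with hg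
  have hkK : k ∈ (((standardMaximalCompactGL 2 E).comap
      (adelicVal F E c 2 ((StdForm.antidiagonal 2).over E)) : Subgroup (quasiSplit F E c 2).Adelic) :
        Set (quasiSplit F E c 2).Adelic) := Subgroup.mem_comap.2 hk
  have hHg : borelHeight g = borelHeight (b : (quasiSplit F E c 2).Adelic) :=
    borelHeight_mul_of_mem_comap_standardMaximalCompactGL (Subgroup.mem_comap.2 hk) _
  have hTg : T < borelHeight g := by rw [hHg]; exact hTb
  have hKg : kernelClass cl i f g g = borelSumClass cl i f g g := hc₀ g (lt_of_le_of_lt hTc₀ hTg)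
  -- the class oscillation head at `g = b k` with the one-factor geometry
  obtain ⟨R, hRsupp, hRle⟩ := hH5 hT1 hTg hKg ρ hgeom
  -- the cell count (row H4-d) for this `R`
  have hcount : (R.card : ℝ≥0∞) * ν 𝓕₀ ≤
      (C₀ : ℝ≥0∞) * ((torusRootModulus E 2 (diagUnit b.2) : ℝ≥0) : ℝ≥0∞) := by
    refine hH4 b hbΩ hb₁ k hkK R fun β hβ => ?_
    obtain ⟨y, hy, hyC⟩ := hRsupp β hβ
    obtain ⟨y', hy', rfl⟩ := mem_image_insert_one_of_mem_insert₈ hy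
    exact ⟨y', hy', hyC⟩
  -- `ν(𝓕₀) ∈ (0, ∞)`
  have hν0 : ν 𝓕₀ ≠ 0 := measure_ne_zero_of_isFundamentalDomain ν h𝓕₀
  have hνtop : ν 𝓕₀ ≠ ⊤ := (lt_of_le_of_lt (measure_mono h𝓕₀W₀) hW₀.measure_lt_top).ne
  have hcard : (R.card : ℝ≥0∞) ≤
      (C₀ : ℝ≥0∞) * ((torusRootModulus E 2 (diagUnit b.2) : ℝ≥0) : ℝ≥0∞) * (ν 𝓕₀)⁻¹ := by
    rw [← div_eq_mul_inv]
    exact (ENNReal.le_div_iff_mul_le (Or.inl hν0) (Or.inl hνtop)).2 hcount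
  -- `‖K_𝔬 − K_{B,𝔬}^{ν,𝓕}‖(g) = ‖k^T_{𝔬;ν,𝓕₀}(g)‖`
  have hKB : kernelBorelClass ν 𝓕 cl i f g g = kernelBorelClass ν 𝓕₀ cl i f g g := by
    rw [kernelBorelClass_eq_of_isFundamentalDomain_two ν ν h𝓕 h𝓕₀ hclN i f]
  have hkT : kernelClass cl i f g g - kernelBorelClass ν 𝓕 cl i f g g = truncatedKernelClass ν 𝓕₀ T cl i f g := by
    rw [hKB, truncatedKernelClass_eq_kernelClass_sub_kernelBorelClass_two hcl hclN ν h𝓕₀ i f hT1 hTg]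
  calc (‖kernelClass cl i f g g - kernelBorelClass ν 𝓕 cl i f g g‖ₑ : ℝ≥0∞)
      = ENNReal.ofReal ‖truncatedKernelClass ν 𝓕₀ T cl i f g‖ := by rw [hkT, ofReal_norm]
    _ ≤ ENNReal.ofReal ((R.card : ℝ) * (L * ρ)) := ENNReal.ofReal_le_ofReal hRle
    _ ≤ (R.card : ℝ≥0∞) * ENNReal.ofReal (L * ρ) := by
        by_cases hρ0 : 0 ≤ L * ρ
        · rw [ENNReal.ofReal_mul (Nat.cast_nonneg _), ENNReal.ofReal_natCast]
        · rw [ENNReal.ofReal_of_nonpos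
            (mul_nonpos_iff.2 (Or.inl ⟨Nat.cast_nonneg _, (not_le.1 hρ0).le⟩))]
          exact bot_le
    _ ≤ (C₀ : ℝ≥0∞) * ((torusRootModulus E 2 (diagUnit b.2) : ℝ≥0) : ℝ≥0∞) * (ν 𝓕₀)⁻¹ *
          ENNReal.ofReal (L * ρ) := mul_le_mul' hcard le_rfl
    _ ≤ (C₀ : ℝ≥0∞) * ((torusRootModulus E 2 (diagUnit b.2) : ℝ≥0) : ℝ≥0∞) * (ν 𝓕₀)⁻¹ *
          (ENNReal.ofReal L * ENNReal.ofReal ρ) := by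
        gcongr
        by_cases hρ : 0 ≤ ρ
        · rw [ENNReal.ofReal_mul hL]
        · rw [ENNReal.ofReal_of_nonpos (mul_nonpos_iff.2 (Or.inl ⟨hL, (not_le.1 hρ).le⟩))]
          exact bot_le
    _ = (C₀ : ℝ≥0∞) * (ν 𝓕₀)⁻¹ * ENNReal.ofReal L *
          (((torusRootModulus E 2 (diagUnit b.2) : ℝ≥0) : ℝ≥0∞) * ENNReal.ofReal ρ) := by ring

/-! ## §2 One majorant `Φ` for every class -/

/-- **`hest ∧ hΦ` FOR EVERY CLASS FROM THE ROWS.**  With the data of §1 on a Siegel set `S ⊆ B(𝔸)` REDUCED above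
height `T₀`, the one-factor geometry at scale `ρ(b)` and the integrability row (`U(J₂)`), the classless
function `Φ := C₀ · ν(𝓕₀)⁻¹ · L · δ_B · ρ` majorises `‖K_𝔬(bk,bk) − K_{B,𝔬}(bk,bk)‖` for the class `𝔬` and
has `∫⁻_{S ∩ {H > T}} Φ dμ_B < ∞`, for every `T > max(1, c₀, T₀)`. [cite: Arthur1978TraceFormulaI, Thm. 7.1]
[cite: Rogawski1990, §2.2 (p. 13)] -/
theorem exists_majorant_class_of_rows_two (ν : Measure (adelicUnipotent F E c 2)) [ν.IsHaarMeasure]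
    {𝓕 𝓕₀ W₀ : Set (adelicUnipotent F E c 2)}
    (h𝓕 : IsFundamentalDomain (rationalUnipotent F E c 2) 𝓕 ν)
    (h𝓕₀ : IsFundamentalDomain (rationalUnipotent F E c 2) 𝓕₀ ν) (hW₀ : IsCompact W₀) (h𝓕₀W₀ : 𝓕₀ ⊆ W₀)
    [MeasurableSpace (quasiSplit F E c 2).Adelic] [BorelSpace (quasiSplit F E c 2).Adelic]
    (μB : Measure (borelAdelic F E c 2)) [μB.IsHaarMeasure]
    {cl : (quasiSplit F E c 2).arithmeticSubgroup → ι} (hcl : IsConjInvariant cl)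
    (hclN : IsUnipotentInvariantOnBorel F E c 2 cl) (i : ι)
    {f : (quasiSplit F E c 2).Adelic → ℂ}
    {S_dir : Set (Matrix (Fin 2) (Fin 2) (mixedSpace E))} {U : Subgroup (GL (Fin 2) (AdeleRing (𝓞 E) E))}
    {L : ℝ} (hL : 0 ≤ L)
    (hH5 : ∀ {T : ℝ≥0}, 1 ≤ T → ∀ {g : (quasiSplit F E c 2).Adelic}, T < borelHeight g →
        kernelClass cl i f g g = borelSumClass cl i f g g → ∀ (ρ : ℝ),
        (∀ u ∈ 𝓕₀, ∃ (t : ℝ) (X : Matrix (Fin 2) (Fin 2) (mixedSpace E))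
            (w : GL (Fin 2) (AdeleRing (𝓞 E) E)), X ∈ S_dir ∧ w ∈ U ∧ |t| ≤ ρ ∧
          adelicVal F E c 2 _ (g⁻¹ * (u : (quasiSplit F E c 2).Adelic) * g) =
            GLn.ofInfinite 2 E (expGL (t • X)) * w) →
        ∃ R : Finset (arithmeticBorel F E c 2),
          (∀ β ∈ R, ∃ y ∈ insert (1 : (quasiSplit F E c 2).Adelic)
              ((fun u : adelicUnipotent F E c 2 => (u : (quasiSplit F E c 2).Adelic)) '' W₀),
            g⁻¹ * (((β : (quasiSplit F E c 2).arithmeticSubgroup)) : (quasiSplit F E c 2).Adelic) *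
              (y * g) ∈ tsupport f) ∧
          ‖truncatedKernelClass ν 𝓕₀ T cl i f g‖ ≤ R.card * (L * ρ))
    {Ω : Set (quasiSplit F E c 2).Adelic} {R₁ : Set (AdeleRing (𝓞 E) E)} {C₀ : ℝ≥0}
    (hH4 : ∀ b : borelAdelic F E c 2,
      (((torusPart b)⁻¹ * b : borelAdelic F E c 2) : (quasiSplit F E c 2).Adelic) ∈ Ω →
      (((diagUnit b.2 0)⁻¹ * diagUnit b.2 1 : (AdeleRing (𝓞 E) E)ˣ) : AdeleRing (𝓞 E) E) ∈ R₁ →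
      ∀ k ∈ (((standardMaximalCompactGL 2 E).comap (adelicVal F E c 2 ((StdForm.antidiagonal 2).over E)) :
          Subgroup (quasiSplit F E c 2).Adelic) : Set (quasiSplit F E c 2).Adelic),
        ∀ R : Finset (arithmeticBorel F E c 2),
        (∀ β ∈ R, ∃ y ∈ insert (1 : adelicUnipotent F E c 2) W₀, ((b : (quasiSplit F E c 2).Adelic) * k)⁻¹ *
          (((β : (quasiSplit F E c 2).arithmeticSubgroup)) : (quasiSplit F E c 2).Adelic) *
          ((y : (quasiSplit F E c 2).Adelic) * ((b : (quasiSplit F E c 2).Adelic) * k)) ∈ tsupport f) →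
        (R.card : ℝ≥0∞) * ν 𝓕₀ ≤ (C₀ : ℝ≥0∞) * ((torusRootModulus E 2 (diagUnit b.2) : ℝ≥0) : ℝ≥0∞))
    {c₀ : ℝ≥0} (hc₀ : ∀ g : (quasiSplit F E c 2).Adelic, c₀ < borelHeight g →
      kernelClass cl i f g g = borelSumClass cl i f g g)
    {S : Set (borelAdelic F E c 2)} {T₀ : ℝ≥0}
    (hSred : ∀ b ∈ S, T₀ < borelHeight (b : (quasiSplit F E c 2).Adelic) →
      (((torusPart b)⁻¹ * b : borelAdelic F E c 2) : (quasiSplit F E c 2).Adelic) ∈ Ω ∧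
      (((diagUnit b.2 0)⁻¹ * diagUnit b.2 1 : (AdeleRing (𝓞 E) E)ˣ) : AdeleRing (𝓞 E) E) ∈ R₁)
    {ρ : borelAdelic F E c 2 → ℝ}
    (hgeom : ∀ b ∈ S, T₀ < borelHeight (b : (quasiSplit F E c 2).Adelic) →
      ∀ k : (quasiSplit F E c 2).Adelic,
      adelicVal F E c 2 ((StdForm.antidiagonal 2).over E) k ∈ standardMaximalCompactGL 2 E →
      ∀ u ∈ 𝓕₀, ∃ (t : ℝ) (X : Matrix (Fin 2) (Fin 2) (mixedSpace E))
        (w : GL (Fin 2) (AdeleRing (𝓞 E) E)), X ∈ S_dir ∧ w ∈ U ∧ |t| ≤ ρ b ∧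
      adelicVal F E c 2 _ ((((b : (quasiSplit F E c 2).Adelic) * k)⁻¹ *
          (u : (quasiSplit F E c 2).Adelic) * ((b : (quasiSplit F E c 2).Adelic) * k))) =
        GLn.ofInfinite 2 E (expGL (t • X)) * w)
    (hH10 : ∀ T : ℝ≥0, T₀ < T →
      ∫⁻ b in S ∩ {b | T < borelHeight (b : (quasiSplit F E c 2).Adelic)},
        ((torusRootModulus E 2 (diagUnit b.2) : ℝ≥0) : ℝ≥0∞) * ENNReal.ofReal (ρ b) ∂μB < ∞)
    {T : ℝ≥0} (hT : max (max 1 c₀) T₀ < T) :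
    ∃ Φ : borelAdelic F E c 2 → ℝ≥0∞,
      (∀ b ∈ S, ∀ k : (quasiSplit F E c 2).Adelic,
        adelicVal F E c 2 ((StdForm.antidiagonal 2).over E) k ∈ standardMaximalCompactGL 2 E →
        T < borelHeight (b : (quasiSplit F E c 2).Adelic) →
        (‖kernelClass cl i f ((b : (quasiSplit F E c 2).Adelic) * k) ((b : (quasiSplit F E c 2).Adelic) * k) -
            kernelBorelClass ν 𝓕 cl i f ((b : (quasiSplit F E c 2).Adelic) * k)
              ((b : (quasiSplit F E c 2).Adelic) * k)‖ₑ : ℝ≥0∞) ≤ Φ b) ∧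
      ∫⁻ b in S ∩ {b | T < borelHeight (b : (quasiSplit F E c 2).Adelic)}, Φ b ∂μB < ∞ := by
  have hT1 : 1 ≤ T := ((le_max_left _ _).trans (le_max_left _ _)).trans hT.le
  have hTc₀ : c₀ ≤ T := ((le_max_right _ _).trans (le_max_left _ _)).trans hT.le
  have hT₀ : T₀ < T := lt_of_le_of_lt (le_max_right _ _) hT
  refine ⟨fun b => (C₀ : ℝ≥0∞) * (ν 𝓕₀)⁻¹ * ENNReal.ofReal L *
      (((torusRootModulus E 2 (diagUnit b.2) : ℝ≥0) : ℝ≥0∞) * ENNReal.ofReal (ρ b)),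
    fun b hb k hk hTb => ?_, ?_⟩
  · have hred := hSred b hb (lt_trans hT₀ hTb)
    exact enorm_kernelClass_sub_kernelBorelClass_le_majorant_two ν h𝓕 h𝓕₀ hW₀ h𝓕₀W₀ hcl hclN i hL hH5 hH4 hc₀
      hT1 hTc₀ hred.1 hred.2 hk hTb (hgeom b hb (lt_trans hT₀ hTb) k hk)
  · have hν0 : ν 𝓕₀ ≠ 0 := measure_ne_zero_of_isFundamentalDomain ν h𝓕₀
    have hK : (C₀ : ℝ≥0∞) * (ν 𝓕₀)⁻¹ * ENNReal.ofReal L ≠ ⊤ :=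
      ENNReal.mul_ne_top (ENNReal.mul_ne_top ENNReal.coe_ne_top (ENNReal.inv_ne_top.2 hν0))
        ENNReal.ofReal_ne_top
    rw [lintegral_const_mul' _ _ hK]
    exact ENNReal.mul_lt_top hK.lt_top (hH10 T hT₀)

end Rows

/-! ## §3 Per-class integrability from the rows -/

/-- **EVERY `k^T_𝔬` IS INTEGRABLE, FROM THE ROWS** (generic quadratic `E/F` with `c² = 1`, `c ≠ 1`; unimodularity
and the adelic Iwasawa decomposition `hBK` as hypotheses).  For a conjugation-invariant, `N(F)`-saturated class map
`cl` of `U(J₂)(F)` and the `N = 2` ROW PACKAGE `hrows` (Siegel set, structure clause with ONE root value,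
one-factor geometry at scale `ρ`, the weight `δ_B ρ` integrable high in the cusp): for every Haar measure `ν` of
`N(𝔸)`, fundamental domain `𝓕`, automorphic measure `μ`, test function `f` and class `𝔬` there is `T₀` with
`[g] ↦ k^T_𝔬(g⁻¹)` `μ`-integrable for all `T > T₀`.  The majorant is the classless one (§2); the last step is ★
`integrable_quotFun_truncatedKernelClass_of_cusp_estimate_two`. [cite: Arthur1978TraceFormulaI, Thm. 7.1]
[cite: Rogawski1990, §2.2 (p. 13)] -/
theorem truncatedKernelClassIntegrable_of_rows_two (hc : c * c = 1) (hc1 : c ≠ 1)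
    (hunimod : ∀ [MeasurableSpace (quasiSplit F E c 2).Adelic] [BorelSpace (quasiSplit F E c 2).Adelic]
      (νG : Measure (quasiSplit F E c 2).Adelic), νG.IsHaarMeasure → νG.IsMulRightInvariant)
    (hBK : ∀ g : (quasiSplit F E c 2).Adelic, ∃ b ∈ borelAdelic F E c 2, ∃ k : (quasiSplit F E c 2).Adelic,
      adelicVal F E c 2 ((StdForm.antidiagonal 2).over E) k ∈ standardMaximalCompactGL 2 E ∧ g = b * k)
    {cl : (quasiSplit F E c 2).arithmeticSubgroup → ι} (hcl : IsConjInvariant cl)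
    (hclN : IsUnipotentInvariantOnBorel F E c 2 cl)
    {S_dir : Set (Matrix (Fin 2) (Fin 2) (mixedSpace E))} (hSdir : IsCompact S_dir)
    (hrows : ∀ [MeasurableSpace (adelicUnipotent F E c 2)] [BorelSpace (adelicUnipotent F E c 2)]
      [MeasurableSpace (quasiSplit F E c 2).Adelic] [BorelSpace (quasiSplit F E c 2).Adelic]
      (ν : Measure (adelicUnipotent F E c 2)) [ν.IsHaarMeasure],
      ∃ (μB : Measure (borelAdelic F E c 2)) (_ : μB.IsHaarMeasure) (S : Set (borelAdelic F E c 2))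
        (Ω : Set (quasiSplit F E c 2).Adelic) (R₁ : Set (AdeleRing (𝓞 E) E)) (T₀ : ℝ≥0),
        IsClosed S ∧
        (∀ b ∈ S, ∀ k : borelAdelic F E c 2,
          adelicVal F E c 2 ((StdForm.antidiagonal 2).over E) (k : (quasiSplit F E c 2).Adelic) ∈
            standardMaximalCompactGL 2 E → b * k ∈ S) ∧
        (∀ g : (quasiSplit F E c 2).Adelic, ∃ β : (quasiSplit F E c 2).arithmeticSubgroup,
          β ∈ arithmeticBorel F E c 2 ∧ ∃ b ∈ S, ∃ k : (quasiSplit F E c 2).Adelic,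
            adelicVal F E c 2 ((StdForm.antidiagonal 2).over E) k ∈ standardMaximalCompactGL 2 E ∧
            (β : (quasiSplit F E c 2).Adelic) * g = (b : (quasiSplit F E c 2).Adelic) * k) ∧
        IsCompact Ω ∧ IsCompact R₁ ∧
        (∀ b ∈ S, T₀ < borelHeight (b : (quasiSplit F E c 2).Adelic) →
          (((torusPart b)⁻¹ * b : borelAdelic F E c 2) : (quasiSplit F E c 2).Adelic) ∈ Ω ∧
          (((diagUnit b.2 0)⁻¹ * diagUnit b.2 1 : (AdeleRing (𝓞 E) E)ˣ) : AdeleRing (𝓞 E) E) ∈ R₁) ∧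
        ∀ U ∈ finiteLevelsGL 2 E, ∃ (𝓕₀ W₀ : Set (adelicUnipotent F E c 2)) (ρ : borelAdelic F E c 2 → ℝ),
          IsFundamentalDomain (rationalUnipotent F E c 2) 𝓕₀ ν ∧ IsCompact W₀ ∧ 𝓕₀ ⊆ W₀ ∧
          (∀ b ∈ S, T₀ < borelHeight (b : (quasiSplit F E c 2).Adelic) →
            ∀ k : (quasiSplit F E c 2).Adelic,
            adelicVal F E c 2 ((StdForm.antidiagonal 2).over E) k ∈ standardMaximalCompactGL 2 E →
            ∀ u ∈ 𝓕₀, ∃ (t : ℝ) (X : Matrix (Fin 2) (Fin 2) (mixedSpace E))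
              (w : GL (Fin 2) (AdeleRing (𝓞 E) E)), X ∈ S_dir ∧ w ∈ U ∧ |t| ≤ ρ b ∧
            adelicVal F E c 2 _ ((((b : (quasiSplit F E c 2).Adelic) * k)⁻¹ *
                (u : (quasiSplit F E c 2).Adelic) * ((b : (quasiSplit F E c 2).Adelic) * k))) =
              GLn.ofInfinite 2 E (expGL (t • X)) * w) ∧
          (∀ T : ℝ≥0, T₀ < T →
            ∫⁻ b in S ∩ {b | T < borelHeight (b : (quasiSplit F E c 2).Adelic)},
              ((torusRootModulus E 2 (diagUnit b.2) : ℝ≥0) : ℝ≥0∞) * ENNReal.ofReal (ρ b) ∂μB < ∞)) :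
    ∀ [MeasurableSpace (adelicUnipotent F E c 2)] [BorelSpace (adelicUnipotent F E c 2)]
      (ν : Measure (adelicUnipotent F E c 2)) [ν.IsHaarMeasure]
      (𝓕 : Set (adelicUnipotent F E c 2)),
      IsFundamentalDomain (rationalUnipotent F E c 2) 𝓕 ν →
        ∀ (μ : Measure (quasiSplit F E c 2).automorphicQuotient)
          [(quasiSplit F E c 2).IsAutomorphicMeasure μ]
          (f : (quasiSplit F E c 2).Adelic → ℂ), IsQuasiSplitTest F E c 2 f →
          ∀ i : ι, ∃ T₀ : ℝ≥0, ∀ T : ℝ≥0, T₀ < T →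
            Integrable ((quasiSplit F E c 2).quotFun (truncatedKernelClass ν 𝓕 T cl i f)) μ := by
  intro mN bN ν hν 𝓕 h𝓕 μ hμ f hf i
  refine integrable_quotFun_truncatedKernelClass_of_cusp_estimate_two hunimod hcl hclN i ?_ ν h𝓕 μ hf
  intro mU bU mG bG νG hνG ν' hν' 𝓕' h𝓕' f' hf'
  obtain ⟨μB, hμB, S, Ω, R₁, T₀, hSc, hSK, hcov, hΩ, hR₁, hSred, hU⟩ := hrows ν'
  have hfs' : HasCompactSupport f' := hf'.hasCompactSupport'
  have hfc' : Continuous f' := hf'.continuous'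
  -- the class oscillation head: the level `U` and the Lipschitz constant `L` of `f'` along `S_dir`
  obtain ⟨U, hUmem, L, hL, hH5⟩ := hf'.exists_level_norm_truncatedKernelClass_le_two hSdir
  -- the geometry and integrability rows at this level
  obtain ⟨𝓕₀, W₀, ρ, h𝓕₀, hW₀, h𝓕₀W₀, hgeom, hH10⟩ := hU U hUmem
  -- row H4-d: the cell count on the reduced set (B-p14's ★ `…CellCountSiegelTwo`, which integrates on the
  -- adele line: Borel structure on `𝔸_E` chosen locally), and the class Siegel constant `c₀`
  haveI := locallyCompactSpace_adeleRing' E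
  letI : MeasurableSpace (AdeleRing (𝓞 E) E) := borel _
  haveI : BorelSpace (AdeleRing (𝓞 E) E) := ⟨rfl⟩
  obtain ⟨C₀, hH4⟩ := exists_forall_card_mul_measure_le_mul_torusRootModulus_two hc hc1 ν' h𝓕₀ hW₀ h𝓕₀W₀
    (hW₀.insert 1) (C := tsupport f') hfs'
    (isCompact_comap_adelicVal_standardMaximalCompactGL (F := F) (E := E) (c := c) (N := 2)) hΩ hR₁
  obtain ⟨c₀, hc₀⟩ := exists_forall_kernelClass_eq_borelSumClass_of_lt_borelHeight_two (c := c) (ι := ι) hfs'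
  refine ⟨max (max 1 c₀) T₀, fun T hT => ?_⟩
  obtain ⟨Φ, hest, hΦ⟩ := exists_majorant_class_of_rows_two ν' h𝓕' h𝓕₀ hW₀ h𝓕₀W₀ μB hcl hclN i hL
    (fun {T'} hT' {g} hg hK ρ' hge => hH5 ν' h𝓕₀ hW₀ h𝓕₀W₀ hT' hg cl hcl hclN i hK ρ' hge) hH4
    (fun g hg => hc₀ cl i g hg) hSred hgeom hH10 hT
  exact exists_cover_setLIntegral_class_lt_top_of_majorant_two νG ν' 𝓕' hBK μB hSc hSK hcov cl i hfc' hest hΦ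

/-- **EVERY `k^T_𝔬` OF `U(J₂)` IS INTEGRABLE, FROM THE ROWS, AT A CM EXTENSION** — `c² = 1`, `c ≠ 1`, unimodularity (★
`forall_isHaarMeasure_isMulRightInvariant_quasiSplit_cm_two`, H-B2) and the adelic Iwasawa decomposition (★
`exists_mem_borelAdelic_mul_mem_standardMaximalCompactGL_cm`, every `N`) DISCHARGED; only `hrows` remains.
[cite: Arthur1978TraceFormulaI, Thm. 7.1] [cite: Rogawski1990, §2.2 (p. 13)] -/
theorem truncatedKernelClassIntegrable_cm_of_rows_two (L : Type) [Field L] [NumberField L] [IsCMField L]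
    {cl : (quasiSplit (↥(maximalRealSubfield L)) L (IsCMField.complexConj L) 2).arithmeticSubgroup → ι}
    (hcl : IsConjInvariant cl)
    (hclN : IsUnipotentInvariantOnBorel (↥(maximalRealSubfield L)) L (IsCMField.complexConj L) 2 cl)
    {S_dir : Set (Matrix (Fin 2) (Fin 2) (mixedSpace L))} (hSdir : IsCompact S_dir)
    (hrows : ∀ [MeasurableSpace (adelicUnipotent (↥(maximalRealSubfield L)) L (IsCMField.complexConj L) 2)]
      [BorelSpace (adelicUnipotent (↥(maximalRealSubfield L)) L (IsCMField.complexConj L) 2)]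
      [MeasurableSpace (quasiSplit (↥(maximalRealSubfield L)) L (IsCMField.complexConj L) 2).Adelic]
      [BorelSpace (quasiSplit (↥(maximalRealSubfield L)) L (IsCMField.complexConj L) 2).Adelic]
      (ν : Measure (adelicUnipotent (↥(maximalRealSubfield L)) L (IsCMField.complexConj L) 2))
      [ν.IsHaarMeasure],
      ∃ (μB : Measure (borelAdelic (↥(maximalRealSubfield L)) L (IsCMField.complexConj L) 2))
        (_ : μB.IsHaarMeasure)
        (S : Set (borelAdelic (↥(maximalRealSubfield L)) L (IsCMField.complexConj L) 2))
        (Ω : Set (quasiSplit (↥(maximalRealSubfield L)) L (IsCMField.complexConj L) 2).Adelic)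
        (R₁ : Set (AdeleRing (𝓞 L) L)) (T₀ : ℝ≥0),
        IsClosed S ∧
        (∀ b ∈ S, ∀ k : borelAdelic (↥(maximalRealSubfield L)) L (IsCMField.complexConj L) 2,
          adelicVal (↥(maximalRealSubfield L)) L (IsCMField.complexConj L) 2 ((StdForm.antidiagonal 2).over L)
            (k : (quasiSplit (↥(maximalRealSubfield L)) L (IsCMField.complexConj L) 2).Adelic) ∈
            standardMaximalCompactGL 2 L → b * k ∈ S) ∧
        (∀ g : (quasiSplit (↥(maximalRealSubfield L)) L (IsCMField.complexConj L) 2).Adelic,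
          ∃ β : (quasiSplit (↥(maximalRealSubfield L)) L (IsCMField.complexConj L) 2).arithmeticSubgroup,
          β ∈ arithmeticBorel (↥(maximalRealSubfield L)) L (IsCMField.complexConj L) 2 ∧ ∃ b ∈ S,
          ∃ k : (quasiSplit (↥(maximalRealSubfield L)) L (IsCMField.complexConj L) 2).Adelic,
            adelicVal (↥(maximalRealSubfield L)) L (IsCMField.complexConj L) 2 ((StdForm.antidiagonal 2).over L) k ∈
              standardMaximalCompactGL 2 L ∧
            (β : (quasiSplit (↥(maximalRealSubfield L)) L (IsCMField.complexConj L) 2).Adelic) * g =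
              (b : (quasiSplit (↥(maximalRealSubfield L)) L (IsCMField.complexConj L) 2).Adelic) * k) ∧
        IsCompact Ω ∧ IsCompact R₁ ∧
        (∀ b ∈ S, T₀ < borelHeight (b : (quasiSplit (↥(maximalRealSubfield L)) L (IsCMField.complexConj L) 2).Adelic) →
          (((torusPart b)⁻¹ * b : borelAdelic (↥(maximalRealSubfield L)) L (IsCMField.complexConj L) 2) :
              (quasiSplit (↥(maximalRealSubfield L)) L (IsCMField.complexConj L) 2).Adelic) ∈ Ω ∧
          (((diagUnit b.2 0)⁻¹ * diagUnit b.2 1 : (AdeleRing (𝓞 L) L)ˣ) : AdeleRing (𝓞 L) L) ∈ R₁) ∧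
        ∀ U ∈ finiteLevelsGL 2 L,
          ∃ (𝓕₀ W₀ : Set (adelicUnipotent (↥(maximalRealSubfield L)) L (IsCMField.complexConj L) 2))
            (ρ : borelAdelic (↥(maximalRealSubfield L)) L (IsCMField.complexConj L) 2 → ℝ),
          IsFundamentalDomain (rationalUnipotent (↥(maximalRealSubfield L)) L (IsCMField.complexConj L) 2) 𝓕₀ ν ∧
          IsCompact W₀ ∧ 𝓕₀ ⊆ W₀ ∧
          (∀ b ∈ S, T₀ < borelHeight (b : (quasiSplit (↥(maximalRealSubfield L)) L (IsCMField.complexConj L) 2).Adelic) →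
            ∀ k : (quasiSplit (↥(maximalRealSubfield L)) L (IsCMField.complexConj L) 2).Adelic,
            adelicVal (↥(maximalRealSubfield L)) L (IsCMField.complexConj L) 2 ((StdForm.antidiagonal 2).over L) k ∈
              standardMaximalCompactGL 2 L →
            ∀ u ∈ 𝓕₀, ∃ (t : ℝ) (X : Matrix (Fin 2) (Fin 2) (mixedSpace L))
              (w : GL (Fin 2) (AdeleRing (𝓞 L) L)), X ∈ S_dir ∧ w ∈ U ∧ |t| ≤ ρ b ∧
            adelicVal (↥(maximalRealSubfield L)) L (IsCMField.complexConj L) 2 _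
                ((((b : (quasiSplit (↥(maximalRealSubfield L)) L (IsCMField.complexConj L) 2).Adelic) * k)⁻¹ *
                  (u : (quasiSplit (↥(maximalRealSubfield L)) L (IsCMField.complexConj L) 2).Adelic) *
                  ((b : (quasiSplit (↥(maximalRealSubfield L)) L (IsCMField.complexConj L) 2).Adelic) * k))) =
              GLn.ofInfinite 2 L (expGL (t • X)) * w) ∧
          (∀ T : ℝ≥0, T₀ < T →
            ∫⁻ b in S ∩ {b | T < borelHeight
                (b : (quasiSplit (↥(maximalRealSubfield L)) L (IsCMField.complexConj L) 2).Adelic)},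
              ((torusRootModulus L 2 (diagUnit b.2) : ℝ≥0) : ℝ≥0∞) * ENNReal.ofReal (ρ b) ∂μB < ∞)) :
    ∀ [MeasurableSpace (adelicUnipotent (↥(maximalRealSubfield L)) L (IsCMField.complexConj L) 2)]
      [BorelSpace (adelicUnipotent (↥(maximalRealSubfield L)) L (IsCMField.complexConj L) 2)]
      (ν : Measure (adelicUnipotent (↥(maximalRealSubfield L)) L (IsCMField.complexConj L) 2)) [ν.IsHaarMeasure]
      (𝓕 : Set (adelicUnipotent (↥(maximalRealSubfield L)) L (IsCMField.complexConj L) 2)),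
      IsFundamentalDomain (rationalUnipotent (↥(maximalRealSubfield L)) L (IsCMField.complexConj L) 2) 𝓕 ν →
        ∀ (μ : Measure (quasiSplit (↥(maximalRealSubfield L)) L (IsCMField.complexConj L) 2).automorphicQuotient)
          [(quasiSplit (↥(maximalRealSubfield L)) L (IsCMField.complexConj L) 2).IsAutomorphicMeasure μ]
          (f : (quasiSplit (↥(maximalRealSubfield L)) L (IsCMField.complexConj L) 2).Adelic → ℂ),
          IsQuasiSplitTest (↥(maximalRealSubfield L)) L (IsCMField.complexConj L) 2 f →
          ∀ i : ι, ∃ T₀ : ℝ≥0, ∀ T : ℝ≥0, T₀ < T →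
            Integrable ((quasiSplit (↥(maximalRealSubfield L)) L (IsCMField.complexConj L) 2).quotFun
              (truncatedKernelClass ν 𝓕 T cl i f)) μ :=
  truncatedKernelClassIntegrable_of_rows_two (complexConj_mul_complexConj L) (IsCMField.complexConj_ne_one L)
    (forall_isHaarMeasure_isMulRightInvariant_quasiSplit_cm_two L)
    ((exists_mem_borelAdelic_mul_mem_standardMaximalCompactGL_cm L)) hcl hclN hSdir hrows

end UnitaryGroup

end Literature.NumberTheory.Automorphic
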